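import Literature.Algebra.Polynomial.CasasAlvero.DigitCriterion
import HarnessLib

/-!
# Reduction of the characteristic-`p` Casas-Alvero problem to the leading digit

Over a PERFECT field `K` of characteristic `p` (e.g. `𝔽̄_p`, every finite field):
`CA_d(K) ⟺ d = 0 ∨ (d = a·p^k with 1 ≤ a ≤ p - 1 and CA_a(K))`
— the digit criterion (`DigitCriterion.lean`) gives the shape `d = a·p^k`, and GvBLSW Prop. 6 in both directions
(`holdsInDegree_mul_prime_pow`, `holdsInDegree_of_mul_prime_pow`) moves between `d` and its leading digit `a`.
Over an arbitrary field of characteristic `p` the forward half holds verbatim (`digit_of_holdsInDegree`).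
-/

noncomputable section

open Polynomial

namespace Literature.Algebra.Polynomial.CasasAlvero

variable (K : Type*) [Field K] (p : ℕ) [Fact p.Prime] [CharP K p]

/-- forward half over ANY field of characteristic `p`: `CA_d(K)`, `d ≠ 0` ⇒ `d = a·p^k` with `1 ≤ a < p` and `CA_a(K)`.
[cite: GrafVonBothmerEtAl2007, Prop. 6] -/
theorem digit_of_holdsInDegree {d : ℕ} (hd : d ≠ 0) (h : HoldsInDegree K d) :
    ∃ k a : ℕ, 0 < a ∧ a < p ∧ d = a * p ^ k ∧ HoldsInDegree K a := by
  obtain ⟨k, a, ha0, hap, rfl⟩ := exists_eq_digit_of_holdsInDegree K p hd h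
  exact ⟨k, a, ha0, hap, rfl, holdsInDegree_of_mul_prime_pow p k h⟩

/-- **leading-digit reduction** over a perfect field of characteristic `p`:
`CA_d(K) ⟺ d = 0 ∨ ∃ k a, 1 ≤ a < p ∧ d = a·p^k ∧ CA_a(K)`. [cite: GrafVonBothmerEtAl2007, Prop. 6] -/
theorem holdsInDegree_iff_digit [PerfectRing K p] (d : ℕ) :
    HoldsInDegree K d ↔ d = 0 ∨ ∃ k a : ℕ, 0 < a ∧ a < p ∧ d = a * p ^ k ∧ HoldsInDegree K a := by
  constructor
  · intro h
    rcases Nat.eq_zero_or_pos d with rfl | hd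
    · exact Or.inl rfl
    · exact Or.inr (digit_of_holdsInDegree K p hd.ne' h)
  · rintro (rfl | ⟨k, a, -, -, rfl, ha⟩)
    · exact holdsInDegree_zero K
    · exact holdsInDegree_mul_prime_pow p ha k

/-- in particular, over a perfect field of characteristic `p`, the Casas-Alvero property holds in ALL degrees
`a·p^k` (`1 ≤ a < p`, `k ≥ 0`) as soon as it holds in the `p - 1` digit degrees `1, …, p-1`. [cite: GrafVonBothmerEtAl2007, Prop. 6] -/
theorem holdsInDegree_of_digits [PerfectRing K p] (hdig : ∀ a, 0 < a → a < p → HoldsInDegree K a) {d : ℕ}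
    (k a : ℕ) (ha0 : 0 < a) (hap : a < p) (hd : d = a * p ^ k) : HoldsInDegree K d := by
  subst hd
  exact holdsInDegree_mul_prime_pow p (hdig a ha0 hap) k

end Literature.Algebra.Polynomial.CasasAlvero
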